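import Mathlib
import Literature.Topology.FourManifolds.CorkPresentationHomotopySphere
import HarnessLib

/-!
# InvolutiveCorkDecomposition

Topic `Literature/Topology/FourManifolds`. Named literature fact(s) relocated by the gate from `Summits/SmoothPoincare4/SmoothPoincare4/Theorems/WeylBudgetCorkRegluingBudgetStubInvolutiveCorkPresentation.lean`
(accept-time relocation of `[cite]`d propositions written inline in a Summits proposal; human ruling 2026-08-15).
Sources: AkbulutYasui2008, KirbyCorks1996.

* `Literature.Topology.FourManifolds.involutiveCorkDecomposition`
-/

namespace Literature.Topology.FourManifolds

open scoped _root_.Manifold _root_.ContDiff _root_.Topology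

/-- **The cork decomposition theorem WITH INVOLUTION** (one-piece form, exterior exposed).
R. Kirby, *Akbulut's corks and h-cobordisms of smooth, simply connected 4-manifolds*, Turkish
J. Math. 20 (1996), arXiv:math/9712231, p. 1 — **Theorem** (Curtis–Freedman–Hsiang–Stong;
Matveyev): "Let `M⁵` be a smooth 5-dimensional h-cobordism between two simply connected, closed
4-manifolds, `M₀` and `M₁`. Then there exists a sub-h-cobordism `A⁵ ⊂ M⁵` between `A₀ ⊂ M₀` and
`A₁ ⊂ M₁` with the properties: (1) `A₀` and hence `A` and `A₁` are compact contractible manifolds,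
and (2) `M − int A` is a product h-cobordism, i.e. it is diffeomorphic to `(M₀ − int A₀) × [0,1]`",
with **Addendum (D)**: "`A₀` is diffeomorphic to `A₁` by a diffeomorphism which, restricted to
`∂A₀ = ∂A₁`, is an involution [mat95]" (proved loc. cit. §5: enlarge `A` to `A ∪ A⁻¹`, whose ends
`(A₀ ∪_{B³} A₁)₀`, `(A₁ ∪_{B³} A₀)₁` "are diffeomorphic by the obvious involution"). The same
statement for homeomorphic pairs is Akbulut–Yasui 2008, Thm. 1.1 ([M], [C], [AM2]): "For every
homeomorphic but non-diffeomorphic pair of simply connected closed 4-manifolds, one is obtained from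
the other by removing a contractible 4-manifold and gluing it via an involution on the boundary."
Rendered in the tree's gluing vocabulary, in the one-piece shape of
`Literature.Topology.FourManifolds.corkDecomposition` with the exterior's instances exposed as in
`Literature.Topology.FourManifolds.Matveyev1996_decomposition` (both of which explicitly omit the
involution): if `X₁`, `X₂` are h-cobordant simply connected closed smooth 4-manifolds, then there are
a compact contractible smooth 4-manifold with boundary `C` (`= A₀`; Hausdorff, second countable), a
compact smooth 4-manifold with boundary `W` (`= M₀ ∖ int A₀`), boundary data `bC`, `bW`, a
diffeomorphism `φ : ∂C ≅ ∂W` and an INVOLUTION `τ` of `∂C` — `τ = ψ⁻¹ ∘ ∂g` for the diffeomorphism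
`g : A₀ ≅ A₁` of (D) and the identification `ψ : ∂A₀ = ∂A₁` of the product structure (2) — with
`X₁ = C ∪_φ W` and `X₂ = C ∪_{φ ∘ τ} W` (`Literature.Topology.FourManifolds.IsBoundaryGluing`; the
second gluing `X₂ = A₁ ∪ (M₁ ∖ int A₁)` transported along `g` and the product structure, cf.
`Literature.Topology.FourManifolds.IsBoundaryGluing.transfer`). Matveyev's own Theorem 1
(J. Differential Geom. 44 (1996); arXiv:dg-ga/9505001, p. 1) prints parts 1–2 without the word
"involution" (it is the swap `W₁ ♮ W₂ ≅ W₂ ♮ W₁` of the proof of part 2 via Fact 1); the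
`H₂`-compatibility clause, Addenda (A)–(C), the extension of `τ` to a self-homeomorphism of `C`
(Freedman) and the Stein refinement (Akbulut–Matveyev 1998) are NOT part of this statement; for
simply connected closed smooth 4-manifolds "h-cobordant" and "homeomorphic" agree (Wall; Freedman),
the h-cobordism form of the sources [M], [C] is kept. Stated at `Type` (existential manifolds in
statements live in `Type`, as `Literature.Topology.FourManifolds.HomotopySphere.carrier`); up to the
order of binders this is the hypothesis `hT` of
`Literature.Barriers.SmoothPoincare4.akbulut1991_notExtendsToDiffeomorph_of_involutiveCorkTheorem`.
Users take `(h : Literature.Topology.FourManifolds.involutiveCorkDecomposition)`.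
[cite: KirbyCorks1996, Theorem and Addendum (D), p. 1 (arXiv:math/9712231), proof of (D) §5]
[cite: AkbulutYasui2008, Thm. 1.1 (arXiv:0806.3010 numbering)]
[file Topology/FourManifolds/InvolutiveCorkDecomposition] -/
def _root_.Literature.Topology.FourManifolds.involutiveCorkDecomposition : Prop :=
  ∀ (X₁ X₂ : Type) [TopologicalSpace X₁] [T2Space X₁] [SecondCountableTopology X₁]
    [ChartedSpace (EuclideanSpace ℝ (Fin 4)) X₁] [IsManifold (𝓡 4) ∞ X₁] [CompactSpace X₁]
    [SimplyConnectedSpace X₁]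
    [TopologicalSpace X₂] [T2Space X₂] [SecondCountableTopology X₂]
    [ChartedSpace (EuclideanSpace ℝ (Fin 4)) X₂] [IsManifold (𝓡 4) ∞ X₂] [CompactSpace X₂]
    [SimplyConnectedSpace X₂],
    Literature.Topology.FourManifolds.IsHCobordant 4 X₁ X₂ →
      ∃ (C : Type) (_ : TopologicalSpace C) (_ : T2Space C) (_ : SecondCountableTopology C)
        (_ : ChartedSpace (EuclideanHalfSpace 4) C) (_ : IsManifold (𝓡∂ 4) ∞ C)
        (_ : CompactSpace C) (_ : ContractibleSpace C)
        (bC : Literature.Topology.FourManifolds.BoundaryData (𝓡∂ 4) C (𝓡 3))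
        (W : Type) (_ : TopologicalSpace W) (_ : T2Space W) (_ : SecondCountableTopology W)
        (_ : ChartedSpace (EuclideanHalfSpace 4) W) (_ : IsManifold (𝓡∂ 4) ∞ W)
        (_ : CompactSpace W)
        (bW : Literature.Topology.FourManifolds.BoundaryData (𝓡∂ 4) W (𝓡 3))
        (φ : bC.carrier ≃ₘ⟮𝓡 3, 𝓡 3⟯ bW.carrier) (τ : bC.carrier ≃ₘ⟮𝓡 3, 𝓡 3⟯ bC.carrier),
        Function.Involutive τ ∧
          Literature.Topology.FourManifolds.IsBoundaryGluing bC bW φ (𝓡 4) X₁ ∧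
            Literature.Topology.FourManifolds.IsBoundaryGluing bC bW (τ.trans φ) (𝓡 4) X₂

end Literature.Topology.FourManifolds
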